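import Mathlib.Algebra.Order.Chebyshev
import Literature.MathematicalPhysics.QuantumLattice.PairCorrelationsProofs
import HarnessLib

/-!
# Box-average (Fejér) bound: the pair-field density is dominated by a windowed sum of the
# translation-averaged pair–pair correlator, for EVERY state on a finite torus

Family `hubbard` (topic `MathematicalPhysics/QuantumLattice`); written for the screening layer of the
Hubbard re-charter (crew hubbard-fast, planner-p2 TARGET §3 S3 "Fejér majorant", WANTED L-3). Let `G`
be a finite abelian group (the torus `(ℤ/Lℤ)²`), `A : G → operators` any family (the local pair
operators `P_x = localPair g L x`), `Δ = Σ_x A_x` (the pair field) and `Q ⊆ G` any finite window (a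
box of side `R+1`). For every vector `ψ`:

  `|Q|² · ⟨Δψ, Δψ⟩ ≤ |G| · Σ_{v,v' ∈ Q} Σ_x Re⟨ψ, A_x† A_{x+(v'-v)} ψ⟩`
  (`card_sq_mul_re_expect_sum_le`),

because `Σ_u (Σ_{v∈Q} A_{u+v}) = |Q| Δ` (every site is counted `|Q|` times) and
`‖Σ_u w_u‖² ≤ |G| Σ_u ‖w_u‖²` (Cauchy–Schwarz) with `w_u = (Σ_{v∈Q} A_{u+v})ψ`, whose squared norms
expand into the windowed correlator sum. The multiplicity `#{(v,v') ∈ Q² : v' - v = r}` is the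
(unnormalised) Fejér kernel of the box — this is Bochner positivity of the pair structure factor
written without Fourier analysis. Specialised to the `d`-wave (or any form factor `g`) pair field of
the torus `(ℤ/Lℤ)²` (`pairField g L = Σ_x localPair g L x`, `|G| = L²`):

  `|Q|² · Re⟨ψ, Δ_g† Δ_g ψ⟩ ≤ L² · Σ_{v,v'∈Q} Σ_x Re⟨ψ, P_x† P_{x+(v'-v)} ψ⟩`
  (`pairField_card_sq_mul_re_expect_le`),

i.e. in the cell's per-site language `p_d(L;ψ) = L⁻⁴ Re⟨Δ†Δ⟩ ≤ |Q|⁻² Σ_{v,v'∈Q} P̄_d(L; v'-v; ψ)` with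
`P̄_d(L;r;ψ) = L⁻² Σ_x Re⟨P_x† P_{x+r}⟩` (`pairFieldDensity_le_box_avgPairCorr_shape`, stated here over
the Literature primitives; the Summits-side row objects `pairFieldDensity` / `avgPairCorr` are these
quotients). A certified CEILING on the windowed correlator sum of a ground state is therefore a
certified ceiling on its pair-field (ODLRO) density; the `r = 0` term `P̄_d(0)/|Q|` with `|Q| = (R+1)²`
is the unavoidable local contribution ("reach floor"); `…_of_injOn` versions take a `ℤ²`-indexed window
(displacements reduced mod `L`, the convention of the cell's correlator rows). Everything is PROVED; no definition, no named
fact, no numerical input.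

### Fejér-weighted form (§4–§5, appended)

Re-indexing the double sum over the discrete cube `Q = {0,…,R}^d` (`halfOpenBox d (R+1)`) by the
displacement `r = v' - v ∈ {-R,…,R}^d` (`box d R`): the multiplicity of `r` is the autocorrelation of
the indicator of the cube, the product of one-dimensional tents
`#{(v,v') ∈ Q² : v' - v = r} = ∏ᵢ (R + 1 - |rᵢ|)` — the lattice side of the classical identity
`(N+1)⁻¹ |Σ_{k=0}^{N} e^{2πikx}|² = Σ_{|j|≤N} (1 - |j|/(N+1)) e^{2πijx}` for the Fejér kernel and of its
separable `n`-dimensional version `F_N^n = (N+1)^{-n} ∏_j |D_N(x_j)|²` (Grafakos 2008, Prop. 3.1.7,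
eq. (3.1.18) — whose printed proof is exactly the count `#{k : |j| ≤ k ≤ N}` — and eqs.
(3.1.22)–(3.1.24)):

* `sum_halfOpenBox_sum_sub_eq_sum_box_tent` —
  `Σ_{v,v' ∈ {0..R}^d} f(v'-v) = Σ_{r ∈ {-R..R}^d} (∏ᵢ (R+1-|rᵢ|)) f(r)` for every `f : ℤ^d → ℝ`
  (`sum_box_prod_tent_eq`: the weights sum to `((R+1)²)^d`);
* `pairFieldDensity_le_tent_sum_avgPairCorr_shape` — for `R + 1 ≤ L` (so that `{0..R}²` embeds in
  the torus, `proj_injOn_halfOpenBox_of_le`) and every `ψ` on the `L × L` torus,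
  `p ≤ Σ_{r ∈ {-R..R}²} ((∏ᵢ (R+1-|rᵢ|)) / (R+1)⁴) · P̄(proj r)` — the planner's literal L-3 form
  `p_d(L;ψ) ≤ Σ_{r ∈ [-R,R]²} a_R(r) · P̄_d(L; r; ψ)` with the normalised separable Fejér kernel;
* `pairFieldDensity_le_fejerKernel_sum_avgPairCorr_shape` — the same with the weight written
  `max 0 (R+1-|r 0|) * max 0 (R+1-|r 1|) / (R+1)^4` (on `box 2 R` the `max 0` is inactive).

The tree's `Literature.Probability.LatticeModels.fejerCount` / `fejerBox` (`FejerKernel.lean`,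
crit-ising toolkit) are the same counts; that file is deliberately NOT imported here (it carries the
Ising transfer-matrix / Gibbs-state closure); the two elementary counting facts needed are proved
privately in §4.

## Mathlib / tree search

REUSED: `pairField`, `localPair` (PairCorrelations), `PosSemidefTrace.expect_conjTranspose_mul`,
`expect`; Mathlib `sq_sum_le_card_mul_sum_sq`, `norm_sum_le`, `Fintype.sum_equiv`, `Equiv.addRight`.
`lean search 'Fejer|fejer|box_avg|card_sq_mul'` in Literature/MathematicalPhysics: nothing for pair
fields (the Summits-side `Rows/TorusPairSumRule` has the full-torus sum rule `Σ_r P̄_d = L² p_d` only).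
§4–§5 also reuse `halfOpenBox`, `box`, `mem_halfOpenBox`, `mem_box`, `card_halfOpenBox`,
`Torus.proj_apply` (Probability/LatticeModels) and Mathlib `Finset.sum_fiberwise_of_maps_to`,
`Finset.card_nbij'`, `Fintype.card_piFinset`, `Int.card_Icc`, `ZMod.intCast_eq_intCast_iff'`,
`Int.emod_eq_of_lt`; `lean search 'fejer|Fejer|tent'`: `Probability/LatticeModels/FejerKernel.lean`
(1-D identity over `range L ⊆ ℕ` and the lower bound `sub_le_fejerCount` only — no `ℤ^d`-cube
identity), `QuantumManyBody/TorusTentKernel.lean` (continuum tent on `ℝ/ℤ`).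

## References

* C. N. Yang, Rev. Mod. Phys. 34 (1962) 694, §3–§4 (ODLRO: the largest eigenvalue of the pair
  density matrix; positivity of `⟨Δ†Δ⟩`). [cite: Yang1962, §3]
* D. J. Scalapino, Phys. Rep. 250 (1995) 329, §2 eqs. (2.2)–(2.4) (pair field, pair–pair
  correlation function). [cite: Scalapino1995, §2]
* S. Bochner / L. Fejér: positive-definite functions on a finite abelian group; the box
  autocorrelation `1_Q ∗ 1_{-Q}` is positive definite. [folklore]
* L. Grafakos, *Classical Fourier Analysis*, 2nd ed., GTM 249, Springer 2008, §3.1.3: Prop. 3.1.7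
  eq. (3.1.18) (Fejér kernel `F_N = Σ_{|j|≤N}(1-|j|/(N+1)) e_j = (N+1)⁻¹|D|²`, proof by counting),
  Def. 3.1.8 and eqs. (3.1.22)–(3.1.24) (the separable kernel `F_N^n` on `𝐓ⁿ`, `F_N^n ≥ 0`).
  [cite: Grafakos2008, Prop. 3.1.7]
-/

noncomputable section

namespace Literature.MathematicalPhysics.QuantumLattice

open Matrix Finset Literature.Probability.LatticeModels
open scoped ComplexOrder BigOperators ComplexConjugate

/-! ### §1 Two scalar facts -/

/-- `‖Σ_{u∈s} a_u‖² ≤ |s| Σ_{u∈s} ‖a_u‖²` (Cauchy–Schwarz). [folklore] -/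
private theorem norm_sum_sq_le_card_mul {ι : Type*} (s : Finset ι) (a : ι → ℂ) :
    ‖∑ u ∈ s, a u‖ ^ 2 ≤ s.card * ∑ u ∈ s, ‖a u‖ ^ 2 :=
  calc ‖∑ u ∈ s, a u‖ ^ 2 ≤ (∑ u ∈ s, ‖a u‖) ^ 2 :=
        pow_le_pow_left₀ (norm_nonneg _) (norm_sum_le s a) 2
    _ ≤ s.card * ∑ u ∈ s, ‖a u‖ ^ 2 := sq_sum_le_card_mul_sum_sq

/-- `Re (v̄ · v) = Σ_i ‖v_i‖²`. [folklore] -/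
private theorem re_star_dotProduct_self {m : Type*} [Fintype m] (v : m → ℂ) :
    (star v ⬝ᵥ v).re = ∑ i, ‖v i‖ ^ 2 := by
  simp only [dotProduct, Pi.star_apply, Complex.re_sum]
  refine Finset.sum_congr rfl fun i _ => ?_
  rw [Complex.star_def, ← Complex.normSq_eq_conj_mul_self, Complex.ofReal_re, Complex.normSq_eq_norm_sq]

/-- **`‖Σ_u w_u‖² ≤ |G| Σ_u ‖w_u‖²` for vectors** (coordinatewise Cauchy–Schwarz). [folklore] -/
private theorem re_star_sum_dotProduct_sum_le {G : Type*} [Fintype G] {m : Type*} [Fintype m]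
    (w : G → m → ℂ) :
    (star (∑ u, w u) ⬝ᵥ ∑ u, w u).re ≤ (Fintype.card G : ℝ) * ∑ u, (star (w u) ⬝ᵥ w u).re := by
  rw [re_star_dotProduct_self]
  simp_rw [re_star_dotProduct_self]
  rw [Finset.sum_comm, Finset.mul_sum]
  refine Finset.sum_le_sum fun i _ => ?_
  rw [Finset.sum_apply]
  exact norm_sum_sq_le_card_mul Finset.univ fun u => w u i

/-! ### §2 The box-average bound for an arbitrary operator family on a finite abelian group -/

section Generic

variable {G : Type*} [AddCommGroup G] [Fintype G]
variable {ι : Type*} [Fintype ι]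

omit [Fintype ι] in
/-- Every site is counted `|Q|` times: `Σ_u Σ_{v∈Q} A_{u+v} = |Q| • Σ_x A_x`. [folklore] -/
private theorem sum_sum_add_eq_card_smul (A : G → Matrix (Finset ι) (Finset ι) ℂ) (Q : Finset G) :
    ∑ u, ∑ v ∈ Q, A (u + v) = (Q.card : ℂ) • ∑ x, A x := by
  rw [Finset.sum_comm]
  have h : ∀ v ∈ Q, ∑ u, A (u + v) = ∑ x, A x := fun v _ =>
    Fintype.sum_equiv (Equiv.addRight v) _ _ fun u => rfl
  rw [Finset.sum_congr rfl h, Finset.sum_const, ← Nat.cast_smul_eq_nsmul ℂ]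

/-- `expect` is additive over finite sums of operators. [folklore] -/
private theorem expect_sum' {β : Type*} (s : Finset β) (X : β → Matrix (Finset ι) (Finset ι) ℂ)
    (ψ : Fock ι) : expect (∑ b ∈ s, X b) ψ = ∑ b ∈ s, expect (X b) ψ := by
  simp [expect, Matrix.sum_mulVec, dotProduct_sum]

/-- **Box-average bound (generic).** For every operator family `A : G → 𝔐` on a finite abelian
group `G`, every finite window `Q ⊆ G` and every vector `ψ`:
`|Q|² Re⟨ψ, (Σ_x A_x)† (Σ_x A_x) ψ⟩ ≤ |G| Σ_{v∈Q} Σ_{v'∈Q} Σ_x Re⟨ψ, A_x† A_{x+(v'-v)} ψ⟩`.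
[cite: Yang1962, §3] -/
theorem card_sq_mul_re_expect_sum_le (A : G → Matrix (Finset ι) (Finset ι) ℂ) (Q : Finset G)
    (ψ : Fock ι) :
    (Q.card : ℝ) ^ 2 * (expect ((∑ x, A x)ᴴ * ∑ x, A x) ψ).re ≤
      (Fintype.card G : ℝ) *
        ∑ v ∈ Q, ∑ v' ∈ Q, ∑ x, (expect ((A x)ᴴ * A (x + (v' - v))) ψ).re := by
  set w : G → Fock ι := fun u => (∑ v ∈ Q, A (u + v)) *ᵥ ψ with hw
  -- `Σ_u w_u = |Q| • Δψ`
  have hsum : ∑ u, w u = (Q.card : ℂ) • ((∑ x, A x) *ᵥ ψ) := by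
    simp only [hw]
    rw [← Matrix.sum_mulVec, sum_sum_add_eq_card_smul, Matrix.smul_mulVec]
  -- the left-hand side is `Re⟨Σ w, Σ w⟩`
  have hL : (Q.card : ℝ) ^ 2 * (expect ((∑ x, A x)ᴴ * ∑ x, A x) ψ).re =
      (star (∑ u, w u) ⬝ᵥ ∑ u, w u).re := by
    rw [PosSemidefTrace.expect_conjTranspose_mul, hsum, star_smul, smul_dotProduct, dotProduct_smul,
      smul_smul, smul_eq_mul, ← Complex.ofReal_natCast, Complex.star_def, Complex.conj_ofReal,
      ← Complex.ofReal_mul, Complex.re_ofReal_mul, sq]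
  -- the right-hand side is `Σ_u Re⟨w_u, w_u⟩`
  have hR : ∑ u, (star (w u) ⬝ᵥ w u).re =
      ∑ v ∈ Q, ∑ v' ∈ Q, ∑ x, (expect ((A x)ᴴ * A (x + (v' - v))) ψ).re := by
    have hu : ∀ u, (star (w u) ⬝ᵥ w u).re =
        ∑ v ∈ Q, ∑ v' ∈ Q, (expect ((A (u + v))ᴴ * A (u + v')) ψ).re := by
      intro u
      rw [hw, ← PosSemidefTrace.expect_conjTranspose_mul, Matrix.conjTranspose_sum, Finset.sum_mul,
        expect_sum', Complex.re_sum]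
      refine Finset.sum_congr rfl fun v _ => ?_
      rw [Finset.mul_sum, expect_sum', Complex.re_sum]
    simp_rw [hu]
    rw [Finset.sum_comm]
    refine Finset.sum_congr rfl fun v _ => ?_
    rw [Finset.sum_comm]
    refine Finset.sum_congr rfl fun v' _ => ?_
    refine Fintype.sum_equiv (Equiv.addRight v) _ _ fun u => ?_
    simp only [Equiv.coe_addRight]
    rw [show u + v + (v' - v) = u + v' by abel]
  rw [hL, ← hR]
  exact re_star_sum_dotProduct_sum_le w

end Generic

/-! ### §3 The pair field of the torus `(ℤ/Lℤ)²` -/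

section Torus

variable (g : Site 2 → ℝ) (L : ℕ) [NeZero L]

/-- **Box-average (Fejér) bound for the pair field.** For every form factor `g`, every window
`Q` of torus sites and every state `ψ` on the torus `(ℤ/Lℤ)²`:
`|Q|² Re⟨ψ, Δ_g† Δ_g ψ⟩ ≤ L² Σ_{v∈Q} Σ_{v'∈Q} Σ_x Re⟨ψ, P_x† P_{x+(v'-v)} ψ⟩`
(`Δ_g = pairField g L = Σ_x localPair g L x`). [cite: Scalapino1995, §2] -/
theorem pairField_card_sq_mul_re_expect_le (Q : Finset (TorusSite 2 L))
    (ψ : Fock (Orb (FermionTorus 2 L))) :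
    (Q.card : ℝ) ^ 2 * (expect ((pairField g L)ᴴ * pairField g L) ψ).re ≤
      (L : ℝ) ^ 2 * ∑ v ∈ Q, ∑ v' ∈ Q, ∑ x : TorusSite 2 L,
        (expect ((localPair g L x)ᴴ * localPair g L (x + (v' - v))) ψ).re := by
  have hcard : (Fintype.card (TorusSite 2 L) : ℝ) = (L : ℝ) ^ 2 := by
    rw [Fintype.card_fun, ZMod.card, Fintype.card_fin]
    push_cast
    ring
  have h := card_sq_mul_re_expect_sum_le (localPair g L) Q ψ
  rw [hcard] at h
  exact h

/-- **Per-site ("row") shape**: with `p = L⁻⁴ Re⟨Δ_g†Δ_g⟩` (pair-field density) and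
`P̄(r) = L⁻² Σ_x Re⟨P_x† P_{x+r}⟩` (translation-averaged pair correlator), for every non-empty
window `Q`: `p ≤ |Q|⁻² Σ_{v,v'∈Q} P̄(v'-v)` — the Summits-side objects `pairFieldDensity`,
`avgPairCorr` are exactly these quotients. [cite: Scalapino1995, §2] -/
theorem pairFieldDensity_le_box_avgPairCorr_shape {Q : Finset (TorusSite 2 L)} (hQ : Q.Nonempty)
    (ψ : Fock (Orb (FermionTorus 2 L))) :
    (expect ((pairField g L)ᴴ * pairField g L) ψ).re / (L : ℝ) ^ 4 ≤
      ((Q.card : ℝ) ^ 2)⁻¹ * ∑ v ∈ Q, ∑ v' ∈ Q,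
        ((∑ x : TorusSite 2 L, (expect ((localPair g L x)ᴴ * localPair g L (x + (v' - v))) ψ).re) /
          (L : ℝ) ^ 2) := by
  have hL : (0 : ℝ) < (L : ℝ) := by exact_mod_cast Nat.pos_of_ne_zero (NeZero.ne L)
  have hL4 : (0 : ℝ) < (L : ℝ) ^ 4 := by positivity
  have hQc : (0 : ℝ) < (Q.card : ℝ) ^ 2 := by
    have : (0 : ℝ) < Q.card := by exact_mod_cast hQ.card_pos
    positivity
  have h := pairField_card_sq_mul_re_expect_le g L Q ψ
  simp_rw [← Finset.sum_div]
  set T : ℝ := ∑ v ∈ Q, ∑ v' ∈ Q, ∑ x : TorusSite 2 L,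
    (expect ((localPair g L x)ᴴ * localPair g L (x + (v' - v))) ψ).re with hT
  set E : ℝ := (expect ((pairField g L)ᴴ * pairField g L) ψ).re with hE
  rw [div_le_iff₀ hL4]
  have e1 : ((Q.card : ℝ) ^ 2)⁻¹ * (T / (L : ℝ) ^ 2) * (L : ℝ) ^ 4 =
      ((Q.card : ℝ) ^ 2)⁻¹ * (T * (L : ℝ) ^ 2) := by
    field_simp
  rw [e1, le_inv_mul_iff₀ hQc]
  linarith [h]

omit [NeZero L] in
/-- `Torus.proj` is additive: `proj (a - b) = proj a - proj b`. [folklore] -/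
private theorem torusProj_sub (a b : Site 2) : Torus.proj L (a - b) = Torus.proj L a - Torus.proj L b := by
  funext i
  simp [Torus.proj, Int.cast_sub]

/-- **Box-average bound with a `ℤ²`-indexed window** (the convention of the cell's correlator rows,
which displace by lattice vectors `r ∈ ℤ²` reduced mod `L`): for a finite window `Q ⊆ ℤ²` on which the
projection to the torus is injective (e.g. a box of side `≤ L`; for `L → ∞` eventually every finite
`Q`, tree `eventually_injOn_proj_of_tendsto`),
`|Q|² Re⟨ψ, Δ_g† Δ_g ψ⟩ ≤ L² Σ_{v,v'∈Q} Σ_x Re⟨ψ, P_x† P_{x + proj(v'-v)} ψ⟩`. [cite: Scalapino1995, §2] -/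
theorem pairField_card_sq_mul_re_expect_le_of_injOn (Q : Finset (Site 2))
    (hQ : Set.InjOn (Torus.proj L) (Q : Set (Site 2))) (ψ : Fock (Orb (FermionTorus 2 L))) :
    (Q.card : ℝ) ^ 2 * (expect ((pairField g L)ᴴ * pairField g L) ψ).re ≤
      (L : ℝ) ^ 2 * ∑ v ∈ Q, ∑ v' ∈ Q, ∑ x : TorusSite 2 L,
        (expect ((localPair g L x)ᴴ * localPair g L (x + Torus.proj L (v' - v))) ψ).re := by
  classical
  have hinj : ∀ a ∈ Q, ∀ b ∈ Q, Torus.proj L a = Torus.proj L b → a = b :=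
    fun a ha b hb h => hQ ha hb h
  have h := pairField_card_sq_mul_re_expect_le g L (Q.image (Torus.proj L)) ψ
  rw [Finset.card_image_of_injOn hQ, Finset.sum_image hinj] at h
  refine h.trans (le_of_eq ?_)
  congr 1
  refine Finset.sum_congr rfl fun v _ => ?_
  rw [Finset.sum_image hinj]
  refine Finset.sum_congr rfl fun v' _ => Finset.sum_congr rfl fun x _ => ?_
  rw [torusProj_sub]

/-- Per-site shape with a `ℤ²`-indexed window: `p ≤ |Q|⁻² Σ_{v,v'∈Q} P̄(proj(v'-v))`, i.e. literally
`pairFieldDensity L ψ ≤ |Q|⁻² Σ_{v,v'∈Q} avgPairCorr L (v'-v) ψ` for the Summits-side row objects.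
[cite: Scalapino1995, §2] -/
theorem pairFieldDensity_le_box_avgPairCorr_shape_of_injOn {Q : Finset (Site 2)} (hQn : Q.Nonempty)
    (hQ : Set.InjOn (Torus.proj L) (Q : Set (Site 2))) (ψ : Fock (Orb (FermionTorus 2 L))) :
    (expect ((pairField g L)ᴴ * pairField g L) ψ).re / (L : ℝ) ^ 4 ≤
      ((Q.card : ℝ) ^ 2)⁻¹ * ∑ v ∈ Q, ∑ v' ∈ Q,
        ((∑ x : TorusSite 2 L,
          (expect ((localPair g L x)ᴴ * localPair g L (x + Torus.proj L (v' - v))) ψ).re) /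
          (L : ℝ) ^ 2) := by
  have hL : (0 : ℝ) < (L : ℝ) := by exact_mod_cast Nat.pos_of_ne_zero (NeZero.ne L)
  have hL4 : (0 : ℝ) < (L : ℝ) ^ 4 := by positivity
  have hQc : (0 : ℝ) < (Q.card : ℝ) ^ 2 := by
    have : (0 : ℝ) < Q.card := by exact_mod_cast hQn.card_pos
    positivity
  have h := pairField_card_sq_mul_re_expect_le_of_injOn g L Q hQ ψ
  simp_rw [← Finset.sum_div]
  set T : ℝ := ∑ v ∈ Q, ∑ v' ∈ Q, ∑ x : TorusSite 2 L,
    (expect ((localPair g L x)ᴴ * localPair g L (x + Torus.proj L (v' - v))) ψ).re with hT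
  rw [div_le_iff₀ hL4]
  have e1 : ((Q.card : ℝ) ^ 2)⁻¹ * (T / (L : ℝ) ^ 2) * (L : ℝ) ^ 4 =
      ((Q.card : ℝ) ^ 2)⁻¹ * (T * (L : ℝ) ^ 2) := by
    field_simp
  rw [e1, le_inv_mul_iff₀ hQc]
  linarith [h]

end Torus

/-! ### §4 Pairs of cube points with prescribed difference: the product-tent count -/

section Counting

variable {d : ℕ}

/-- One-dimensional count: for `|k| ≤ R`, `#{(a,b) ∈ {0,…,R}² : b - a = k} = R + 1 - |k|`
(the pairs are `(a, a+k)` with `max(0,-k) ≤ a ≤ min(R, R-k)`). (Grafakos 2008, proof of Prop. 3.1.7,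
the count `#{k : |j| ≤ k ≤ N}`.) [cite: Grafakos2008, Prop. 3.1.7] -/
private theorem card_Ico_prod_filter_sub_eq (R : ℕ) {k : ℤ} (hk : |k| ≤ R) :
    ((((Finset.Ico (0 : ℤ) ((R + 1 : ℕ) : ℤ)) ×ˢ (Finset.Ico (0 : ℤ) ((R + 1 : ℕ) : ℤ))).filter
        fun q : ℤ × ℤ => q.2 - q.1 = k).card : ℤ) = (R : ℤ) + 1 - |k| := by
  have hset : (((Finset.Ico (0 : ℤ) ((R + 1 : ℕ) : ℤ)) ×ˢ (Finset.Ico (0 : ℤ) ((R + 1 : ℕ) : ℤ))).filter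
        fun q : ℤ × ℤ => q.2 - q.1 = k) =
      (Finset.Icc (max 0 (-k)) (min (R : ℤ) (R - k))).map
        ⟨fun a => (a, a + k), fun a b h => (Prod.ext_iff.1 h).1⟩ := by
    ext ⟨a, b⟩
    simp only [Finset.mem_filter, Finset.mem_product, Finset.mem_Ico, Finset.mem_map,
      Finset.mem_Icc, Function.Embedding.coeFn_mk, Prod.mk.injEq, Nat.cast_add, Nat.cast_one]
    constructor
    · rintro ⟨⟨⟨ha0, haR⟩, hb0, hbR⟩, hab⟩
      exact ⟨a, ⟨by omega, by omega⟩, rfl, by omega⟩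
    · rintro ⟨a', ⟨h1, h2⟩, rfl, rfl⟩
      exact ⟨⟨⟨by omega, by omega⟩, by omega, by omega⟩, by omega⟩
  rw [hset, Finset.card_map, Int.card_Icc]
  rcases abs_cases k with ⟨h, hk0⟩ | ⟨h, hk0⟩ <;> rw [h] at hk ⊢ <;> omega

/-- `d`-dimensional count: for `r ∈ {-R,…,R}^d`,
`#{(v,v') ∈ ({0,…,R}^d)² : v' - v = r} = ∏ᵢ (R + 1 - |rᵢ|)` (the fibre is a product of
one-dimensional fibres). (Grafakos 2008, (3.1.23)–(3.1.24): the `n`-dimensional Fejér kernel is the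
product of the one-dimensional ones.) [cite: Grafakos2008, Prop. 3.1.7] -/
private theorem card_halfOpenBox_prod_filter_sub_eq (R : ℕ) {r : Site d} (hr : r ∈ box d R) :
    ((((halfOpenBox d (R + 1)) ×ˢ (halfOpenBox d (R + 1))).filter
        fun p : Site d × Site d => p.2 - p.1 = r).card : ℤ) = ∏ i, ((R : ℤ) + 1 - |r i|) := by
  classical
  rw [mem_box] at hr
  have hcard : (((halfOpenBox d (R + 1)) ×ˢ (halfOpenBox d (R + 1))).filter
        fun p : Site d × Site d => p.2 - p.1 = r).card =
      (Fintype.piFinset fun i => ((Finset.Ico (0 : ℤ) ((R + 1 : ℕ) : ℤ)) ×ˢ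
        (Finset.Ico (0 : ℤ) ((R + 1 : ℕ) : ℤ))).filter fun q : ℤ × ℤ => q.2 - q.1 = r i).card := by
    refine Finset.card_nbij' (fun p i => (p.1 i, p.2 i))
      (fun q => (fun i => (q i).1, fun i => (q i).2)) ?_ ?_ ?_ ?_
    · intro p hp
      have hp' := Finset.mem_filter.1 (Finset.mem_coe.1 hp)
      obtain ⟨hp1, hp2⟩ := hp'
      rw [Finset.mem_product, mem_halfOpenBox, mem_halfOpenBox] at hp1
      refine Finset.mem_coe.2 (Fintype.mem_piFinset.2 fun i => ?_)
      have e : p.2 i - p.1 i = r i := by rw [← hp2]; rfl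
      simp only [Finset.mem_filter, Finset.mem_product, Finset.mem_Ico]
      exact ⟨⟨hp1.1 i, hp1.2 i⟩, e⟩
    · intro q hq
      have hq' := Fintype.mem_piFinset.1 (Finset.mem_coe.1 hq)
      refine Finset.mem_coe.2 (Finset.mem_filter.2 ⟨?_, ?_⟩)
      · rw [Finset.mem_product, mem_halfOpenBox, mem_halfOpenBox]
        refine ⟨fun i => ?_, fun i => ?_⟩
        · have := Finset.mem_filter.1 (hq' i)
          rw [Finset.mem_product, Finset.mem_Ico, Finset.mem_Ico] at this
          exact this.1.1
        · have := Finset.mem_filter.1 (hq' i)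
          rw [Finset.mem_product, Finset.mem_Ico, Finset.mem_Ico] at this
          exact this.1.2
      · funext i
        have := (Finset.mem_filter.1 (hq' i)).2
        exact this
    · intro p _
      rfl
    · intro q _
      rfl
  rw [hcard, Fintype.card_piFinset, Nat.cast_prod]
  exact Finset.prod_congr rfl fun i _ => card_Ico_prod_filter_sub_eq R (abs_le.2 ⟨(hr i).1, (hr i).2⟩)

/-- **Autocorrelation of the discrete cube = product tent (the lattice Fejér identity).** For every
`f : ℤ^d → ℝ`,
`Σ_{v ∈ {0..R}^d} Σ_{v' ∈ {0..R}^d} f(v' - v) = Σ_{r ∈ {-R..R}^d} (∏ᵢ (R + 1 - |rᵢ|)) · f(r)`.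
(Grafakos 2008, Prop. 3.1.7 eq. (3.1.18) and (3.1.24): `(N+1)^{-n} ∏_j |D_N(x_j)|² =
Σ_{|m_j|≤N} ∏_j (1-|m_j|/(N+1)) e^{2πi m·x}`, read off coefficient-wise.) [cite: Grafakos2008, Prop. 3.1.7] -/
theorem sum_halfOpenBox_sum_sub_eq_sum_box_tent (R : ℕ) (f : Site d → ℝ) :
    ∑ v ∈ halfOpenBox d (R + 1), ∑ v' ∈ halfOpenBox d (R + 1), f (v' - v) =
      ∑ r ∈ box d R, (∏ i, ((R : ℝ) + 1 - |(r i : ℝ)|)) * f r := by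
  classical
  rw [← Finset.sum_product (s := halfOpenBox d (R + 1)) (t := halfOpenBox d (R + 1))
    (f := fun p => f (p.2 - p.1))]
  have hmaps : ∀ p ∈ (halfOpenBox d (R + 1)) ×ˢ (halfOpenBox d (R + 1)), p.2 - p.1 ∈ box d R := by
    intro p hp
    rw [Finset.mem_product, mem_halfOpenBox, mem_halfOpenBox] at hp
    rw [mem_box]
    intro i
    have h1 := hp.1 i
    have h2 := hp.2 i
    have e : (p.2 - p.1) i = p.2 i - p.1 i := rfl
    rw [e]
    push_cast at h1 h2
    constructor <;> omega
  rw [← Finset.sum_fiberwise_of_maps_to hmaps]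
  refine Finset.sum_congr rfl fun r hr => ?_
  have hconst : ∀ p ∈ ((halfOpenBox d (R + 1)) ×ˢ (halfOpenBox d (R + 1))).filter
      (fun p => p.2 - p.1 = r), f (p.2 - p.1) = f r := by
    intro p hp
    have := (Finset.mem_filter.1 hp).2
    rw [this]
  rw [Finset.sum_congr rfl hconst, Finset.sum_const, nsmul_eq_mul]
  congr 1
  have h := card_halfOpenBox_prod_filter_sub_eq R hr
  have h' : ((((((halfOpenBox d (R + 1)) ×ˢ (halfOpenBox d (R + 1))).filter
      fun p : Site d × Site d => p.2 - p.1 = r).card : ℤ)) : ℝ) =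
        ((∏ i, ((R : ℤ) + 1 - |r i|) : ℤ) : ℝ) := by
    rw [h]
  push_cast at h'
  exact h'

/-- The total weight: `Σ_{r ∈ {-R..R}^d} ∏ᵢ (R + 1 - |rᵢ|) = ((R+1)^d)²` (the `f ≡ 1` case: the
number of pairs of cube points). [cite: Grafakos2008, Prop. 3.1.7] -/
theorem sum_box_prod_tent_eq (R : ℕ) :
    ∑ r ∈ box d R, (∏ i, ((R : ℝ) + 1 - |(r i : ℝ)|)) = (((R : ℝ) + 1) ^ d) ^ 2 := by
  have h := sum_halfOpenBox_sum_sub_eq_sum_box_tent (d := d) R (fun _ => (1 : ℝ))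
  simp only [mul_one, Finset.sum_const, card_halfOpenBox] at h
  rw [← h]
  ring

/-- The projection `ℤ^d → (ℤ/Lℤ)^d` is injective on the cube `{0,…,M-1}^d` as soon as `M ≤ L`.
(Friedli–Velenik 2017, §3.1: the torus as a quotient of `ℤ^d`.) [cite: FriedliVelenik2017, §3.1] -/
theorem proj_injOn_halfOpenBox_of_le {M L : ℕ} (hML : M ≤ L) :
    Set.InjOn (Torus.proj (d := d) L) (halfOpenBox d M : Set (Site d)) := by
  intro x hx y hy h
  rw [Finset.mem_coe, mem_halfOpenBox] at hx hy
  funext i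
  have hi : ((x i : ℤ) : ZMod L) = ((y i : ℤ) : ZMod L) := by
    have := congrFun h i
    simpa only [Torus.proj_apply] using this
  rw [ZMod.intCast_eq_intCast_iff'] at hi
  obtain ⟨hx0, hxM⟩ := hx i
  obtain ⟨hy0, hyM⟩ := hy i
  have hML' : (M : ℤ) ≤ (L : ℤ) := by exact_mod_cast hML
  rwa [Int.emod_eq_of_lt hx0 (lt_of_lt_of_le hxM hML'),
    Int.emod_eq_of_lt hy0 (lt_of_lt_of_le hyM hML')] at hi

end Counting

/-! ### §5 The Fejér-weighted majorant of the pair-field density on the torus `(ℤ/Lℤ)²` -/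

section TorusFejer

variable (g : Site 2 → ℝ) (L : ℕ) [NeZero L]

/-- **Fejér / tent-weighted majorant, every state.** For `R + 1 ≤ L`, every form factor `g` and
every vector `ψ` on the `L × L` torus:
`L⁻⁴ Re⟨ψ, Δ_g†Δ_g ψ⟩ ≤ Σ_{r ∈ {-R..R}²} ((∏ᵢ (R+1-|rᵢ|)) / (R+1)⁴) · (L⁻² Σ_x Re⟨ψ, P_x† P_{x + proj r} ψ⟩)`,
i.e. `p_d(L;ψ) ≤ Σ_r a_R(r) P̄_d(L; r; ψ)` with the normalised separable Fejér kernel `a_R`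
(weights `≥ 0`, total `1`, `a_R(0) = (R+1)^{-2}`). It is
`pairFieldDensity_le_box_avgPairCorr_shape_of_injOn` for the window `{0..R}²` re-indexed by the
displacement (`sum_halfOpenBox_sum_sub_eq_sum_box_tent`); Fourier-side it is Bochner positivity of
the pair structure factor tested against `F_R² ≥ 0` (Grafakos 2008, (3.1.24)).
[cite: Scalapino1995, §2] [cite: Grafakos2008, Prop. 3.1.7] -/
theorem pairFieldDensity_le_tent_sum_avgPairCorr_shape (R : ℕ) (hRL : R + 1 ≤ L)
    (ψ : Fock (Orb (FermionTorus 2 L))) :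
    (expect ((pairField g L)ᴴ * pairField g L) ψ).re / (L : ℝ) ^ 4 ≤
      ∑ r ∈ box 2 R, ((∏ i, ((R : ℝ) + 1 - |(r i : ℝ)|)) / ((R : ℝ) + 1) ^ 4) *
        ((∑ x : TorusSite 2 L,
          (expect ((localPair g L x)ᴴ * localPair g L (x + Torus.proj L r)) ψ).re) / (L : ℝ) ^ 2) := by
  have hQn : (halfOpenBox 2 (R + 1)).Nonempty := ⟨0, by simp [mem_halfOpenBox]⟩
  have hQ : Set.InjOn (Torus.proj L) (halfOpenBox 2 (R + 1) : Set (Site 2)) :=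
    proj_injOn_halfOpenBox_of_le hRL
  have h := pairFieldDensity_le_box_avgPairCorr_shape_of_injOn g L hQn hQ ψ
  have e := sum_halfOpenBox_sum_sub_eq_sum_box_tent (d := 2) R (fun r => (∑ x : TorusSite 2 L,
      (expect ((localPair g L x)ᴴ * localPair g L (x + Torus.proj L r)) ψ).re) / (L : ℝ) ^ 2)
  beta_reduce at e
  rw [e, card_halfOpenBox, Finset.mul_sum] at h
  refine h.trans (le_of_eq (Finset.sum_congr rfl fun r _ => ?_))
  have hR : ((R : ℝ) + 1) ≠ 0 := by positivity
  push_cast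
  field_simp

/-- The same bound with the weight written coordinate-wise as
`max 0 (R+1-|r 0|) * max 0 (R+1-|r 1|) / (R+1)^4` (the planner's `fejerKernel R r`; on `{-R..R}²` the
`max 0` is inactive). [cite: Scalapino1995, §2] [cite: Grafakos2008, Prop. 3.1.7] -/
theorem pairFieldDensity_le_fejerKernel_sum_avgPairCorr_shape (R : ℕ) (hRL : R + 1 ≤ L)
    (ψ : Fock (Orb (FermionTorus 2 L))) :
    (expect ((pairField g L)ᴴ * pairField g L) ψ).re / (L : ℝ) ^ 4 ≤
      ∑ r ∈ box 2 R,
        (max 0 ((R : ℝ) + 1 - |(r 0 : ℝ)|) * max 0 ((R : ℝ) + 1 - |(r 1 : ℝ)|) / ((R : ℝ) + 1) ^ 4) *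
        ((∑ x : TorusSite 2 L,
          (expect ((localPair g L x)ᴴ * localPair g L (x + Torus.proj L r)) ψ).re) / (L : ℝ) ^ 2) := by
  refine (pairFieldDensity_le_tent_sum_avgPairCorr_shape g L R hRL ψ).trans (le_of_eq ?_)
  refine Finset.sum_congr rfl fun r hr => ?_
  rw [mem_box] at hr
  have h0 : |((r 0 : ℤ) : ℝ)| ≤ (R : ℝ) := by
    rw [abs_le]
    exact ⟨by exact_mod_cast (hr 0).1, by exact_mod_cast (hr 0).2⟩
  have h1 : |((r 1 : ℤ) : ℝ)| ≤ (R : ℝ) := by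
    rw [abs_le]
    exact ⟨by exact_mod_cast (hr 1).1, by exact_mod_cast (hr 1).2⟩
  rw [Fin.prod_univ_two, max_eq_right (by linarith), max_eq_right (by linarith)]

end TorusFejer

end Literature.MathematicalPhysics.QuantumLattice

end
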